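import Mathlib
import Summits.MatrixMultiplication.MatrixMultiplication.Theorems.SoloBlindFlatConjecture

/-!
# Conjecture K♭ at corank one (every rank)

Sub-programme (K₃), Conjecture K♭ (K3.39, statement `soloBlindKFlatAt` in `SoloBlindFlatConjecture`):
`K(τ; S) ≤ 1 + 2^{-ρ} - 2^{ρ-c}` for the core rank `ρ` and core size `c`.  Here: the case `S = B ∪ {p}` with `B` subset-sum
distinct (CORANK ONE), in every rank and for every target — `soloBlind_kflat_corank_one`.

Proof (K3.45).  `τ` has at most the two representations `A ⊆ B` and `A' ∪ {p}` (`A' ⊆ B`).  With at most one representation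
K♭ holds for any `S` (`soloBlind_kflat_of_card_le_one`: `K = 2^{-c} ≤ 1 + 2^{-ρ} - 2^{ρ-c}` as `ρ ≤ c`).  With both, zero-sum
freeness gives `A ⊄ A'`, the core is `A ∪ A' ∪ {p}` of size `c = |A ∪ A'| + 1`, and `h p = ∑_A h - ∑_{A'} h` lies in the span of
`h(A ∪ A')`, so `ρ ≤ c - 1`; since the bound decreases in `ρ` (`soloBlind_flatBound_anti`) it suffices that
`2^{-|A|} + 2^{-|A'|-1} ≤ 1/2 + 2^{-|A ∪ A'|}` (`soloBlind_twoRep_ineq`), which is an equality when `|A| = 1` or `A' = ∅` (the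
tight layer `c = ρ + 1`) and otherwise `≤ 1/4 + 1/4`.
-/

namespace Summit.MatrixMultiplication.MatrixMultiplication.Theorems

open Finset

universe u

variable {ι : Type*} [DecidableEq ι]
variable {G : Type u} [AddCommGroup G] [DecidableEq G]

/-- `2^{-c} ≤ 1 + 2^{-ρ} - 2^{ρ-c}` for `ρ ≤ c`. -/
theorem soloBlind_pow_le_flatBound {ρ c : ℕ} (h : ρ ≤ c) : (1 / 2 : ℚ) ^ c ≤ soloBlindFlatBound ρ c := by
  unfold soloBlindFlatBound
  rcases Nat.eq_or_lt_of_le h with rfl | hlt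
  · rw [Nat.sub_self, pow_zero]
    linarith
  · have h1 : (1 / 2 : ℚ) ^ (c - ρ) ≤ 1 / 2 := by
      calc (1 / 2 : ℚ) ^ (c - ρ) ≤ (1 / 2 : ℚ) ^ 1 := pow_le_pow_of_le_one (by norm_num) (by norm_num) (by omega)
        _ = 1 / 2 := pow_one _
    have h2 : (1 / 2 : ℚ) ^ c ≤ 1 / 2 := by
      calc (1 / 2 : ℚ) ^ c ≤ (1 / 2 : ℚ) ^ 1 := pow_le_pow_of_le_one (by norm_num) (by norm_num) (by omega)
        _ = 1 / 2 := pow_one _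
    have h3 : 0 ≤ (1 / 2 : ℚ) ^ ρ := by positivity
    linarith

/-- The bound `1 + 2^{-ρ} - 2^{ρ-c}` decreases in `ρ` (`ρ ≤ ρ' ≤ c`). -/
theorem soloBlind_flatBound_anti {ρ ρ' c : ℕ} (h : ρ ≤ ρ') (hc : ρ' ≤ c) :
    soloBlindFlatBound ρ' c ≤ soloBlindFlatBound ρ c := by
  unfold soloBlindFlatBound
  have h1 : (1 / 2 : ℚ) ^ ρ' ≤ (1 / 2 : ℚ) ^ ρ := pow_le_pow_of_le_one (by norm_num) (by norm_num) h
  have h2 : (1 / 2 : ℚ) ^ (c - ρ) ≤ (1 / 2 : ℚ) ^ (c - ρ') :=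
    pow_le_pow_of_le_one (by norm_num) (by norm_num) (by omega)
  linarith

/-- K♭ WITH AT MOST ONE REPRESENTATION (any `S`): the core is that representation `T`, `K ≤ 2^{-|T|}`, `ρ ≤ c = |T|`. -/
theorem soloBlind_kflat_of_card_le_one [Module (ZMod 3) G] {h : ι → G} {S : Finset ι} {τ : G}
    (hR : (soloBlindSeqRepAll h S τ).card ≤ 1) : soloBlindKFlatAt h S τ := by
  unfold soloBlindKFlatAt
  by_cases hempty : soloBlindSeqRepAll h S τ = ∅
  · have h0 : soloBlindMass h S τ = 0 := by rw [soloBlindMass, hempty, Finset.sum_empty]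
    rw [h0]
    exact soloBlind_flatBound_nonneg _ _
  · obtain ⟨T, hT⟩ := Finset.nonempty_iff_ne_empty.2 hempty
    have hcore := soloBlind_core_of_card_le_one hR hT
    have hmass : soloBlindMass h S τ ≤ (1 / 2 : ℚ) ^ T.card :=
      soloBlind_mass_le_pow_of_card_le_one h S τ T.card hR
        (fun T' hT' => by rw [Finset.card_le_one.1 hR T' hT' T hT])
    have hρ := soloBlind_coreRank_le_card h S τ
    rw [hcore] at hρ ⊢
    exact hmass.trans (soloBlind_pow_le_flatBound hρ)

/-- The two-representation inequality: `2^{-|A|} + 2^{-|A'|-1} ≤ 1/2 + 2^{-|A ∪ A'|}` whenever `A ⊄ A'`. -/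
theorem soloBlind_twoRep_ineq (A A' : Finset ι) (hnot : ¬ A ⊆ A') :
    (1 / 2 : ℚ) ^ A.card + (1 / 2 : ℚ) ^ (A'.card + 1) ≤ 1 / 2 + (1 / 2 : ℚ) ^ (A ∪ A').card := by
  obtain ⟨x, hxA, hxA'⟩ := Finset.not_subset.1 hnot
  by_cases hA' : A' = ∅
  · subst hA'
    rw [Finset.union_empty, Finset.card_empty, zero_add, pow_one]
    linarith
  · have ha' : 1 ≤ A'.card := Finset.card_pos.2 (Finset.nonempty_iff_ne_empty.2 hA')
    have ha : 1 ≤ A.card := Finset.card_pos.2 ⟨x, hxA⟩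
    rcases Nat.eq_or_lt_of_le ha with ha1 | ha2
    · -- `A = {x}`: equality
      obtain ⟨y, hy⟩ := Finset.card_eq_one.1 ha1.symm
      have hyx : y = x := by rw [hy, Finset.mem_singleton] at hxA; exact hxA.symm
      subst hyx
      rw [hy, Finset.card_singleton, pow_one, show ({y} : Finset ι) ∪ A' = insert y A' from rfl,
        Finset.card_insert_of_notMem hxA']
    · have h1 : (1 / 2 : ℚ) ^ A.card ≤ 1 / 4 := by
        calc (1 / 2 : ℚ) ^ A.card ≤ (1 / 2 : ℚ) ^ 2 := pow_le_pow_of_le_one (by norm_num) (by norm_num) ha2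
          _ = 1 / 4 := by norm_num
      have h2 : (1 / 2 : ℚ) ^ (A'.card + 1) ≤ 1 / 4 := by
        calc (1 / 2 : ℚ) ^ (A'.card + 1) ≤ (1 / 2 : ℚ) ^ 2 :=
            pow_le_pow_of_le_one (by norm_num) (by norm_num) (by omega)
          _ = 1 / 4 := by norm_num
      have h3 : 0 ≤ (1 / 2 : ℚ) ^ (A ∪ A').card := by positivity
      linarith

/-- Representations of `τ` on `B ∪ {p}`: those avoiding `p` represent `τ` on `B`, those through `p` represent `τ - h p` on `B`
after deleting `p`. -/
theorem soloBlind_repAll_insert_cases {h : ι → G} {B : Finset ι} {p : ι} {τ : G} {T : Finset ι}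
    (hT : T ∈ soloBlindSeqRepAll h (insert p B) τ) :
    (p ∉ T → T ∈ soloBlindSeqRepAll h B τ) ∧ (p ∈ T → T.erase p ∈ soloBlindSeqRepAll h B (τ - h p)) := by
  obtain ⟨hTS, hsum⟩ := soloBlind_mem_seqRepAll.1 hT
  refine ⟨fun hp => soloBlind_mem_seqRepAll.2 ⟨?_, hsum⟩, fun hp => soloBlind_mem_seqRepAll.2 ⟨?_, ?_⟩⟩
  · intro x hx
    rcases Finset.mem_insert.1 (hTS hx) with rfl | hxB
    · exact absurd hx hp
    · exact hxB
  · exact Finset.subset_insert_iff.1 hTS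
  · rw [Finset.sum_erase_eq_sub hp, hsum]

/-- CONJECTURE K♭ AT CORANK ONE (every rank): `B` subset-sum distinct for `h`, `p ∉ B`, `h` zero-sum free on `S = B ∪ {p}` ⟹
`K(τ; S) ≤ 1 + 2^{-ρ} - 2^{ρ-c}` for every target `τ` (core rank `ρ`, core size `c`). -/
theorem soloBlind_kflat_corank_one [Module (ZMod 3) G] {h : ι → G} {B : Finset ι} {p : ι} (hpB : p ∉ B)
    (hdist : ∀ A ⊆ B, ∀ A' ⊆ B, ∑ i ∈ A, h i = ∑ i ∈ A', h i → A = A')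
    (zsf : ∀ T ⊆ insert p B, T.Nonempty → ∑ i ∈ T, h i ≠ 0) (τ : G) :
    soloBlindKFlatAt h (insert p B) τ := by
  classical
  have hR1 : (soloBlindSeqRepAll h B τ).card ≤ 1 := soloBlind_repAll_card_le_one_of_sumDistinct hdist τ
  have hR'1 : (soloBlindSeqRepAll h B (τ - h p)).card ≤ 1 :=
    soloBlind_repAll_card_le_one_of_sumDistinct hdist (τ - h p)
  by_cases hA : (soloBlindSeqRepAll h B τ).Nonempty
  swap
  · -- no representation avoids `p`: at most one representation in all
    rw [Finset.not_nonempty_iff_eq_empty] at hA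
    apply soloBlind_kflat_of_card_le_one
    refine Finset.card_le_one.2 (fun T₁ hT₁ T₂ hT₂ => ?_)
    have hp1 : p ∈ T₁ := by
      by_contra hp; have := (soloBlind_repAll_insert_cases hT₁).1 hp; rw [hA] at this; simp at this
    have hp2 : p ∈ T₂ := by
      by_contra hp; have := (soloBlind_repAll_insert_cases hT₂).1 hp; rw [hA] at this; simp at this
    have e := Finset.card_le_one.1 hR'1 _ ((soloBlind_repAll_insert_cases hT₁).2 hp1) _
      ((soloBlind_repAll_insert_cases hT₂).2 hp2)
    rw [← Finset.insert_erase hp1, ← Finset.insert_erase hp2, e]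
  by_cases hA' : (soloBlindSeqRepAll h B (τ - h p)).Nonempty
  swap
  · -- no representation passes through `p`: at most one representation in all
    rw [Finset.not_nonempty_iff_eq_empty] at hA'
    apply soloBlind_kflat_of_card_le_one
    refine Finset.card_le_one.2 (fun T₁ hT₁ T₂ hT₂ => ?_)
    have hp1 : p ∉ T₁ := by
      intro hp; have := (soloBlind_repAll_insert_cases hT₁).2 hp; rw [hA'] at this; simp at this
    have hp2 : p ∉ T₂ := by
      intro hp; have := (soloBlind_repAll_insert_cases hT₂).2 hp; rw [hA'] at this; simp at this
    exact Finset.card_le_one.1 hR1 _ ((soloBlind_repAll_insert_cases hT₁).1 hp1) _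
      ((soloBlind_repAll_insert_cases hT₂).1 hp2)
  -- both representations present
  obtain ⟨A, hAm⟩ := hA
  obtain ⟨A', hA'm⟩ := hA'
  obtain ⟨hAB, hAs⟩ := soloBlind_mem_seqRepAll.1 hAm
  obtain ⟨hA'B, hA's⟩ := soloBlind_mem_seqRepAll.1 hA'm
  have hpA : p ∉ A := fun hp => hpB (hAB hp)
  have hpA' : p ∉ A' := fun hp => hpB (hA'B hp)
  set T₂ : Finset ι := insert p A' with hT₂
  have hT₂m : T₂ ∈ soloBlindSeqRepAll h (insert p B) τ := by
    refine soloBlind_mem_seqRepAll.2 ⟨Finset.insert_subset_insert p hA'B, ?_⟩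
    rw [hT₂, Finset.sum_insert hpA', hA's]
    abel
  have hAm' : A ∈ soloBlindSeqRepAll h (insert p B) τ :=
    soloBlind_mem_seqRepAll.2 ⟨hAB.trans (Finset.subset_insert p B), hAs⟩
  -- every representation is `A` or `T₂`
  have hall : ∀ T ∈ soloBlindSeqRepAll h (insert p B) τ, T = A ∨ T = T₂ := by
    intro T hT
    by_cases hp : p ∈ T
    · right
      have e := Finset.card_le_one.1 hR'1 _ ((soloBlind_repAll_insert_cases hT).2 hp) _ hA'm
      rw [← Finset.insert_erase hp, e]
    · left
      exact Finset.card_le_one.1 hR1 _ ((soloBlind_repAll_insert_cases hT).1 hp) _ hAm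
  have hrep : soloBlindSeqRepAll h (insert p B) τ = {A, T₂} := by
    ext T
    rw [Finset.mem_insert, Finset.mem_singleton]
    exact ⟨fun hT => hall T hT, fun hT => by rcases hT with rfl | rfl <;> assumption⟩
  have hne : A ≠ T₂ := fun e => hpA (by rw [e, hT₂]; exact Finset.mem_insert_self p A')
  -- zero-sum freeness: `A ⊄ A'`
  have hnot : ¬ A ⊆ A' := by
    intro hsub
    apply zsf (insert p (A' \ A)) (Finset.insert_subset_insert p (Finset.sdiff_subset.trans hA'B))
      (Finset.insert_nonempty p _)
    rw [Finset.sum_insert (fun hp => hpA' (Finset.mem_sdiff.1 hp).1), Finset.sum_sdiff_eq_sub hsub, hAs, hA's]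
    abel
  -- the mass
  have hmass : soloBlindMass h (insert p B) τ = (1 / 2 : ℚ) ^ A.card + (1 / 2 : ℚ) ^ (A'.card + 1) := by
    rw [soloBlindMass, hrep, Finset.sum_pair hne, hT₂, Finset.card_insert_of_notMem hpA']
  -- the core and its size
  have hcore : soloBlindCore h (insert p B) τ = insert p (A ∪ A') := by
    rw [soloBlindCore, hrep, Finset.biUnion_insert, Finset.singleton_biUnion, id, id, hT₂, Finset.union_insert]
  have hpU : p ∉ A ∪ A' := fun hp => by
    rcases Finset.mem_union.1 hp with hp | hp
    · exact hpA hp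
    · exact hpA' hp
  have hcard : (soloBlindCore h (insert p B) τ).card = (A ∪ A').card + 1 := by
    rw [hcore, Finset.card_insert_of_notMem hpU]
  -- the core rank is at most `|A ∪ A'|`
  have hrank : soloBlindCoreRank h (insert p B) τ ≤ (A ∪ A').card := by
    unfold soloBlindCoreRank
    rw [hcore]
    have hp_span : h p ∈ Submodule.span (ZMod 3) (↑((A ∪ A').image h) : Set G) := by
      have e : h p = ∑ i ∈ A, h i - ∑ i ∈ A', h i := by rw [hAs, hA's]; abel
      rw [e]
      refine Submodule.sub_mem _ (Submodule.sum_mem _ fun i hi => Submodule.subset_span ?_)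
        (Submodule.sum_mem _ fun i hi => Submodule.subset_span ?_)
      · rw [Finset.coe_image]; exact ⟨i, Finset.mem_coe.2 (Finset.mem_union_left _ hi), rfl⟩
      · rw [Finset.coe_image]; exact ⟨i, Finset.mem_coe.2 (Finset.mem_union_right _ hi), rfl⟩
    have h1 : Submodule.span (ZMod 3) (h '' (↑(insert p (A ∪ A')) : Set ι))
        ≤ Submodule.span (ZMod 3) (↑((A ∪ A').image h) : Set G) := by
      refine Submodule.span_le.2 ?_
      rintro v ⟨x, hx, rfl⟩
      rw [Finset.mem_coe, Finset.mem_insert] at hx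
      rcases hx with rfl | hx
      · exact hp_span
      · refine Submodule.subset_span ?_
        rw [Finset.coe_image]
        exact ⟨x, Finset.mem_coe.2 hx, rfl⟩
    calc Module.finrank (ZMod 3) (Submodule.span (ZMod 3) (h '' (↑(insert p (A ∪ A')) : Set ι)))
        ≤ Module.finrank (ZMod 3) (Submodule.span (ZMod 3) (↑((A ∪ A').image h) : Set G)) :=
          Submodule.finrank_mono h1
      _ ≤ ((A ∪ A').image h).card := finrank_span_finset_le_card _
      _ ≤ (A ∪ A').card := Finset.card_image_le
  -- assemble
  unfold soloBlindKFlatAt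
  rw [hmass, hcard]
  calc (1 / 2 : ℚ) ^ A.card + (1 / 2 : ℚ) ^ (A'.card + 1)
      ≤ 1 / 2 + (1 / 2 : ℚ) ^ (A ∪ A').card := soloBlind_twoRep_ineq A A' hnot
    _ = soloBlindFlatBound (A ∪ A').card ((A ∪ A').card + 1) := by
        unfold soloBlindFlatBound
        rw [show (A ∪ A').card + 1 - (A ∪ A').card = 1 by omega, pow_one]
        ring
    _ ≤ soloBlindFlatBound (soloBlindCoreRank h (insert p B) τ) ((A ∪ A').card + 1) :=
        soloBlind_flatBound_anti hrank (by omega)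

end Summit.MatrixMultiplication.MatrixMultiplication.Theorems
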